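import Summits.HodgeConjecture.HodgeConjecture.Theorems.VHCAbelianSchemesRoadWeilLineAnchors
import Summits.HodgeConjecture.CorCM.AndrePolarizedFormHolds
import Literature.AlgebraicGeometry.HodgeTheory.KodairaEmbeddingHyperplaneClass
import HarnessLib

/-!
# Road b02 (`VHCAbelianSchemesRoad`) × the André column — KODAIRA GLUE FOR THE LINE FACTS: Lemme 6.3.2 discharged by the CorCM kernel theorem, so `HC_CM`
# (and `HC_AV` with `HC_CM` idle) need only Lemme 6.3.3 ALONE in line form, Kodaira's embedding theorem, the door and ONE carried class per tensor structure
# (route-free)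

research route, not a corollary; conditional on HC_CM plus one named minimal statement.

The andre-pencil lane (`Theorems/VHCAbelianSchemesRoadAndreAnchoredPencilsAlgebraic`, p529100; route-free twin `AndreAnchoredPencilsAlgebraicOfKodairaRouteFree`, b03x)
discharged André 1992 = Lemme 6.3.2 from CorCM's KERNEL theorem `andre1992_hodgeClasses_cmType_mem_span_pullback_polarizedHyperbolicWeilClassesCM_holds`
(a rational `(p,p)` class on a CM abelian variety lies in the span of pull-backs of Weil classes of POLARIZED hyperbolic split CM-field data), converting the
polarization class into a hyperplane class by Kodaira (`Kodaira1954_rationalKaehlerClass_eq_hyperplaneClass`, a named fact): the combined facts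
`andre1996_cmHodgeClasses_algebraicallyAnchoredPencils` / `…_weilTensorPencils` / `…_ellipticPowerPencils` follow from Kodaira ∧ Lemme 6.3.3 ALONE
(the literature seat's fact / this seat's tensor form). This file does the same for the LINE form of PART AD-II and draws the consequences, route-free:

* §1 **`andre1996_cmHodgeClasses_weilLinePencils_of_kodaira_of_splitWeilLinePencil : Kodaira → andre1996_splitWeilClasses_weilLinePencil →
  andre1996_cmHodgeClasses_weilLinePencils`** (p529100 §1–§2 inlined for the line predicate; zero new mathematics);
* §2 **`cmHodgeHypothesisAt_of_kodaira_of_splitWeilLinePencil_of_door_of_oneTensorWeilHodgeClassCarriers`**: Kodaira ∧ Lemme 6.3.3 alone (line form) ∧ the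
  door for `𝒪` ∧ `OneTensorWeilHodgeClassCarriers 𝒪 E₀` ⟹ `CMHodgeHypothesisAt B` for every `B` — `HC_CM` with ONE André fact (6.3.3 alone), the CM-reduction
  (6.3.2) being KERNEL; with Lemme 6.3.1 and CM-algebraic carriers: `HC_AV`, `HC_CM` idle; and BOTH axes (`HC_CM` and the split Weil classes of every CM field)
  from Kodaira ∧ ONE André fact ∧ the door ∧ ONE carried class per tensor structure.

HONEST: Kodaira's theorem and Lemme 6.3.3 (line form) are THEOREMS IN PRINT entering BY NAME; Lemme 6.3.2 is a theorem OF THE TREE (CorCM, modulo the tree's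
discharged Deligne–Milne Thm. 6.20); every carrier statement is OPEN, not in print, NOT implied by the Hodge conjecture; the door is the road's binder. Nothing
here says any carrier, door, Weil class, `HC_CM`, `HC_AV` or HC holds. References: [cite: Andre1996Motifs, §6.3 Lemmes 6.3.1–6.3.3 and proof of 6.3.3 (pp. 31–33)]
[cite: Andre1992HodgeCM, Théorème] [cite: Deligne1982HodgeCycles, §4 Thm. 4.8 (a)–(b), Cor. 4.2; §5] [cite: Huybrechts2005, Prop. 5.3.1, Cor. 5.3.3]
[cite: VoisinHodgeI2002, Thm. 7.11] [cite: MoonenZarhin1998WeilClasses, §1] [cite: Bloch1972Semiregularity, Remark (7.5)] [cite: Milne1999, §7 p. 72].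
-/

noncomputable section

open CategoryTheory CategoryTheory.Limits AlgebraicGeometry Topology

namespace Summit.HodgeConjecture.HodgeConjecture.Ring2.SemiregularRepresentatives

-- the cell's namespace repeats the summit name (`Summit.HodgeConjecture.HodgeConjecture…`), as in every `Ring2*` file
set_option linter.dupNamespace false

open Literature.AlgebraicGeometry Literature.AlgebraicGeometry.Motives
open Literature.AlgebraicGeometry.HodgeTheory
open Literature.AlgebraicGeometry.Deligne1982
open Literature.AlgebraicGeometry.VanGeemen1994 (pullbackOne)
open Literature.AlgebraicTopology.SingularHomology
open Literature.AlgebraicGeometry.Milne1999 (IsOfCMType CMHodgeHypothesisAt)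
open Literature.AlgebraicGeometry.Andre1996 (andre1996_cmAnchoredPencil andre1996_splitWeilClasses_weilLinePencil andre1996_cmHodgeClasses_weilLinePencils
  andre1996_splitWeilClasses_weilTensorPencil andre1996_cmHodgeClasses_weilTensorPencils)
open Summit.HodgeConjecture.CorCM.AndreSplit (andre1992_hodgeClasses_cmType_mem_span_pullback_polarizedHyperbolicWeilClassesCM_holds)
open Summit.Ventures.HSemireg (ObjClass LocalVariationalHodgeFor)
open Summit.HodgeConjecture.HodgeConjecture.Ring2.AbelianAll (OneTensorWeilHodgeClassCarriers)

/-! ## §1 The CM line fact from Kodaira and Lemme 6.3.3 alone (line form) -/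

/-- **`andre1996_cmHodgeClasses_weilLinePencils ⟸ Kodaira ∧ andre1996_splitWeilClasses_weilLinePencil`** — Lemme 6.3.2 supplied by CorCM's kernel theorem (André
1992 from Deligne–Milne Thm. 6.20, proved in the tree): a rational `(p,p)` class on a CM abelian variety `B`, `p > 1`, lies in the span of pull-backs `g^*(w)` of rational
Weil classes `w ∈ W_E(B') ⊗ ℂ` of POLARIZED hyperbolic split CM-field data `(B', η, R, e₀, p)`; Kodaira makes the polarization class the hyperplane class `e^*a` of a
projective embedding (Rosati-compatible, split — André's `(*)` in the tree's typing); Lemme 6.3.3 alone (line form, `n = 1`) anchors `(B', η, w)` at the prescribed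
`E₀` with its `E`-line of Weil sections; the span is monotone. [cite: Andre1996Motifs, §6.3 Lemme 6.3.2 (p. 32), Lemme 6.3.3 and proof (p. 33)]
[cite: Andre1992HodgeCM, Théorème] [cite: Deligne1982HodgeCycles, §4 Thm. 4.8 (a)–(b)] [cite: Huybrechts2005, Prop. 5.3.1, Cor. 5.3.3] -/
theorem andre1996_cmHodgeClasses_weilLinePencils_of_kodaira_of_splitWeilLinePencil (hK : Kodaira1954_rationalKaehlerClass_eq_hyperplaneClass)
    (h633 : andre1996_splitWeilClasses_weilLinePencil) : andre1996_cmHodgeClasses_weilLinePencils := by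
  intro E₀ hE₀ B _ hCM p hp c hc hpp
  obtain ⟨R, e₀, -, hspan⟩ := andre1992_hodgeClasses_cmType_mem_span_pullback_polarizedHyperbolicWeilClassesCM_holds B hCM
  refine Submodule.span_mono ?_ (hspan p (by omega) c hc hpp)
  rintro _ ⟨B', g, η, w, -, hP, hw, hwQ, -, rfl⟩
  -- Kodaira: the polarization class of the datum is the hyperplane class of a projective embedding
  obtain ⟨hW, h, hpol, hKm, hros, -, hhyp⟩ := hP
  have hd : 0 < B'.dim := by have := hW.two_le_dim; omega
  obtain ⟨e, a, ha, ha0, hea⟩ := hK (AbelianVariety.isSmoothProjective_holds (A := B')) hd h hpol.isRationalClass hKm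
  rw [← hea] at hros hhyp
  -- Lemme 6.3.3 alone, line form, anchors `(B', η, w)` at `E₀`
  obtain ⟨𝒳, S, f, hf⟩ := h633 E₀ hE₀ R e₀ p hp 1 (fun _ => B') (fun _ => η) (fun _ => e) (fun _ => a) (fun _ => w)
    (fun _ => hW) (fun _ => ⟨ha, ha0⟩) (fun _ => hros) (fun _ => hhyp) (fun _ => hw) (fun _ => hwQ)
  exact ⟨B', g, η, R, e₀, e, a, w, 𝒳, S, f, hW, ha, ha0, hros, hhyp, hw, hwQ, hf 0, rfl⟩

/-! ## §2 `HC_CM`, `HC_AV` (with `HC_CM` idle) and both axes from Kodaira, ONE André fact, the door and ONE carried class per tensor structure -/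

variable {𝒪 : ObjClass}

/-- **`HC_CM` FROM KODAIRA, LEMME 6.3.3 ALONE (line form), THE DOOR AND ONE CARRIED CLASS PER TENSOR STRUCTURE OVER ONE ELLIPTIC CURVE**: `CMHodgeHypothesisAt B` for every
`B` — André's CM reduction (6.3.2) being a theorem of the tree. [cite: Andre1996Motifs, §6.3 (pp. 32–33)] [cite: Andre1992HodgeCM, Théorème]
[cite: MoonenZarhin1998WeilClasses, §1] [cite: Milne1999, §7 p. 72] -/
theorem cmHodgeHypothesisAt_of_kodaira_of_splitWeilLinePencil_of_door_of_oneTensorWeilHodgeClassCarriers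
    (hK : Kodaira1954_rationalKaehlerClass_eq_hyperplaneClass) (h633 : andre1996_splitWeilClasses_weilLinePencil) (hT : LocalVariationalHodgeFor 𝒪)
    {E₀ : AbelianVariety ℂ} (hE₀ : E₀.dim = 1) (hone : OneTensorWeilHodgeClassCarriers 𝒪 E₀) (B : AbelianVariety ℂ) : CMHodgeHypothesisAt B :=
  cmHodgeHypothesisAt_of_weilLinePencils_of_door_of_oneTensorWeilHodgeClassCarriers
    (andre1996_cmHodgeClasses_weilLinePencils_of_kodaira_of_splitWeilLinePencil hK h633) hT hE₀ hone B

/-- **`HC_AV` with `HC_CM` idle, from Kodaira, Lemme 6.3.1, Lemme 6.3.3 alone (line form), the door, CM-algebraic carriers and one carried Weil class per tensor structure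
over one elliptic curve.** [cite: Andre1996Motifs, §6.3 Lemmes 6.3.1–6.3.3 (pp. 31–33)] [cite: Andre1992HodgeCM, Théorème] [cite: Bloch1972Semiregularity, Remark (7.5)] -/
theorem forall_hodgeConjectureFor_of_kodaira_of_andre1996_of_splitWeilLinePencil_of_door_of_cmAlgebraic_of_oneCarried
    (hK : Kodaira1954_rationalKaehlerClass_eq_hyperplaneClass) (h₂₁ : andre1996_cmAnchoredPencil) (h633 : andre1996_splitWeilClasses_weilLinePencil)
    (hT : LocalVariationalHodgeFor 𝒪)
    (hcm : ∀ n p : ℕ, 2 ≤ p → 2 * p + 4 ≤ n → AnchoredCarrierAt 𝒪 n p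
      (fun X θ ↦ (∃ A₀ : AbelianVariety ℂ, A₀.dim = n ∧ IsOfCMType A₀ ∧ Nonempty (A₀.X ≅ X)) ∧ IsPolarizationClass n X θ)
      (fun X _ ↦ (algebraicClasses X p : Set (complexBetti X (2 * p)))))
    {E₀ : AbelianVariety ℂ} (hE₀ : E₀.dim = 1) (hone : OneTensorWeilHodgeClassCarriers 𝒪 E₀) :
    ∀ A : AbelianVariety ℂ, HodgeConjectureFor A.dim A.X :=
  forall_hodgeConjectureFor_of_andre1996_of_weilLinePencils_of_door_of_cmAlgebraic_of_oneCarried h₂₁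
    (andre1996_cmHodgeClasses_weilLinePencils_of_kodaira_of_splitWeilLinePencil hK h633) hT hcm hE₀ hone

/-- **BOTH AXES FROM KODAIRA, ONE ANDRÉ FACT, THE DOOR AND ONE CARRIED CLASS PER TENSOR STRUCTURE**: `(∀ B, CMHodgeHypothesisAt B)` ∧ (every rational Weil class of every
split `E`-Weil datum, every CM field, every `p ≥ 1`, is algebraic). [cite: Andre1996Motifs, §6.3 (pp. 31–33)] [cite: Andre1992HodgeCM, Théorème] [cite: MoonenZarhin1998WeilClasses, §1] -/
theorem cmHodge_and_splitWeil_of_kodaira_of_splitWeilLinePencil_of_door_of_oneTensorWeilHodgeClassCarriers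
    (hK : Kodaira1954_rationalKaehlerClass_eq_hyperplaneClass) (h633 : andre1996_splitWeilClasses_weilLinePencil) (hT : LocalVariationalHodgeFor 𝒪)
    {E₀ : AbelianVariety ℂ} (hE₀ : E₀.dim = 1) (hone : OneTensorWeilHodgeClassCarriers 𝒪 E₀) :
    (∀ B : AbelianVariety ℂ, CMHodgeHypothesisAt B) ∧
      ∀ (B : AbelianVariety ℂ) (η : B ⟶ B) (R : Polynomial ℤ) (e₀ p : ℕ) (e : ProjectiveEmbedding B.X)
        (a : complexBetti (projectiveSpace e.n ℂ) 2), IsWeilTypeCM B η R e₀ p → IsRationalClass a → a ≠ 0 →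
        (∀ x y : complexBetti B.X 1,
          polarizationPairingOne B.X (complexBetti.map e.ι 2 a) (B.dim - 1) (pullbackOne B η x) y =
            -polarizationPairingOne B.X (complexBetti.map e.ι 2 a) (B.dim - 1) x (pullbackOne B η y)) →
        IsHyperbolicWeilType B η (p * e₀) (complexBetti.map e.ι 2 a) →
          ∀ w ∈ weilClassesField B η (R.comp (Polynomial.X ^ 2)) (2 * p), IsRationalClass w → w ∈ algebraicClasses B.X p :=
  ⟨cmHodgeHypothesisAt_of_kodaira_of_splitWeilLinePencil_of_door_of_oneTensorWeilHodgeClassCarriers hK h633 hT hE₀ hone,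
    fun _ _ _ _ _ _ _ hB ha ha₀ hRos hsplit _ hw hwQ ↦
      splitWeilClass_mem_algebraicClasses_of_weilLinePencil_of_door_of_oneTensorWeilHodgeClassCarriers h633 hT hE₀ hone hB ha ha₀ hRos hsplit hw hwQ⟩

/-- **The tensor-form twin for the all-classes node** (AC-f / AD-a rows with ONE André fact): Kodaira ∧ `andre1996_splitWeilClasses_weilTensorPencil` ∧ the door ∧ Weil-tensor
carriers over ONE `E₀` ⟹ `CMHodgeHypothesisAt B` for every `B` (p529100's `…_weilTensorPencils_of_kodaira_of_splitWeilTensorPencil` re-proved here route-free in two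
lines rather than imported from the route-importing module). [cite: Andre1996Motifs, §6.3 (pp. 32–33)] [cite: Andre1992HodgeCM, Théorème] [cite: Milne1999, §7 p. 72] -/
theorem cmHodgeHypothesisAt_of_kodaira_of_splitWeilTensorPencil_of_door_of_anchoredCarrierAt (hK : Kodaira1954_rationalKaehlerClass_eq_hyperplaneClass)
    (h633 : andre1996_splitWeilClasses_weilTensorPencil) (hT : LocalVariationalHodgeFor 𝒪) {E₀ : AbelianVariety ℂ} (hE₀ : E₀.dim = 1)
    (hcar : ∀ d p : ℕ, 2 ≤ p → p + 2 ≤ d → AnchoredCarrierAt 𝒪 d p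
      (Summit.HodgeConjecture.HodgeConjecture.Ring2.AbelianAll.ellipticPowerPolarisedAnchorOf E₀ d)
      (Summit.HodgeConjecture.HodgeConjecture.Ring2.AbelianAll.weilStructureServedClasses d p))
    (B : AbelianVariety ℂ) : CMHodgeHypothesisAt B := by
  refine cmHodgeHypothesisAt_of_weilTensorPencils_of_door_of_anchoredCarrierAt (fun E₀' hE₀' B' hB' hCM p hp c hc hpp ↦ ?_) hT hE₀ hcar B
  obtain ⟨R, e₀, -, hspan⟩ := andre1992_hodgeClasses_cmType_mem_span_pullback_polarizedHyperbolicWeilClassesCM_holds B' hCM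
  refine Submodule.span_mono ?_ (hspan p (by omega) c hc hpp)
  rintro _ ⟨B'', g, η, w, -, hP, hw, hwQ, -, rfl⟩
  obtain ⟨hW, h, hpol, hKm, hros, -, hhyp⟩ := hP
  have hd : 0 < B''.dim := by have := hW.two_le_dim; omega
  obtain ⟨e, a, ha, ha0, hea⟩ := hK (AbelianVariety.isSmoothProjective_holds (A := B'')) hd h hpol.isRationalClass hKm
  rw [← hea] at hros hhyp
  obtain ⟨𝒳, S, f, hf⟩ := h633 E₀' hE₀' R e₀ p hp 1 (fun _ => B'') (fun _ => η) (fun _ => e) (fun _ => a) (fun _ => w)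
    (fun _ => hW) (fun _ => ⟨ha, ha0⟩) (fun _ => hros) (fun _ => hhyp) (fun _ => hw) (fun _ => hwQ)
  exact ⟨B'', g, w, B''.dim, 𝒳, S, f, hf 0, rfl⟩

end Summit.HodgeConjecture.HodgeConjecture.Ring2.SemiregularRepresentatives

end
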